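import Mathlib
import Literature.NumberTheory.LFunctions.GeneralizedRH
import Summits.Parity.GeneralizedHardyLittlewood.Theses.LiouvilleMAD
import Summits.Parity.GeneralizedHardyLittlewood.Theorems.LiouvilleMADCosetDecorrelationStubNormalForm
import Summits.Parity.GeneralizedHardyLittlewood.Theorems.LiouvilleMADCosetDecorrelationStubCosetParseval
import Summits.Parity.GeneralizedHardyLittlewood.Theorems.LiouvilleMADCosetDecorrelationStubWelchBound
import Summits.Parity.GeneralizedHardyLittlewood.Theorems.LiouvilleMADCosetDecorrelationStubCalibrationL1
import Summits.Parity.GeneralizedHardyLittlewood.Theorems.LiouvilleMADCosetDecorrelationStubQuasiRHOfProgressionMean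
import Summits.Parity.GeneralizedHardyLittlewood.Theorems.LiouvilleMADCosetDecorrelationStubWelchFloor
import Summits.Parity.GeneralizedHardyLittlewood.Theorems.LiouvilleMADCosetDecorrelationStubMeanFreeEngine
import Summits.Parity.GeneralizedHardyLittlewood.Theorems.LiouvilleMADCosetDecorrelationStubMeanFreeOfMeanCorrected
import Summits.Parity.GeneralizedHardyLittlewood.Theorems.LiouvilleMADCosetDecorrelationStubCharacterPretender
import Summits.Parity.GeneralizedHardyLittlewood.Theorems.CosetDecorrelation.Negative.CosetDecorrelationDegenerations

/-!
# Line `SketchIdeator3` (card `farey-level-mean-coupling`) for the crux `LiouvilleMAD.CosetDecorrelation`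
(stmt-Parity-13317) — registered skeleton of the line lead `prover-line-stmt-Parity-13317-0`,
re-registered unchanged (stubs byte-identical) by the continuation lead `prover-line-stmt-Parity-13317-c1-0` (2026-08-16)

Crux (`T_j(n,n')` = the coset sum of the route file, verbatim):
`∀ c ≠ 0, ∃ ϑ < 1/4, ∃ C, ∀ M, 1 ≤ n ≠ n' ≤ 2M, j ∈ [⌊√M⌋+1, 2⌊√M⌋+2):
  |Σ_{(m,m') ∈ (M,2M]², m ≡ m' (mod j)} λ(mn+c) λ(m'n'+c)| ≤ C · M^{3/4+ϑ}`.

**The seam (idea card `farey-level-mean-coupling`, IdeatorMemo3).**  `T_j = Σ_{a mod j} A_n(a) A_{n'}(a)` is ONE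
inner product on `ℤ/j` of the two class-sum profiles `A_n(a) = Σ_{m ≡ a (j)} λ(mn+c)`; its level-1 (mean × mean)
part is `S(n)S(n')/j`, `S(n) = Σ_{m∈(M,2M]} λ(mn+c)`, and `T_j − S(n)S(n')/j = Σ_a (A_n(a) − S(n)/j)(A_{n'}(a) − S(n')/j)`
(mean coupling; stub `stub_normalForm`, provable now, general weights).  The line is the honest two-stub normal
form:

* `stub_progressionMeanPowerSaving` (K2, ONE-POINT): `|S(n)| ≤ C·M^{3/4−κ/2}` for all `1 ≤ n ≤ 2M` — a power
  saving for `λ` in ONE class of ONE modulus `n ≤ 2M` at height `≍ nM`.  OPEN: for `n = 1` it is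
  `L(2M+c) − L(M+c) ≪ M^{3/4−κ/2}`, i.e. quasi-RH(3/4 − κ/2) by the Mertens dictionary (tree:
  `quasiRiemannHypothesis_of_mertens_isBigO_holds`, after `μ = λ ∗ (μ ∘ √)`); for `n ≍ M` it is Montgomery-grade
  (beyond GRH: the pointwise GRH bound `(nM)^{1/2+ε} ≥ M` is trivial there).
* `stub_meanCorrectedCosetDecorrelation` (K1, the RESIDUAL, rank 2 of the line, held by the lead): the crux with its
  level-1 term removed, same quantifiers: `|T_j − S(n)S(n')/j| ≤ C·M^{3/4+ϑ}`, `ϑ < 1/4`.  OPEN, crux-grade: still a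
  square-root-regime bilinear statement, false for every real-character pretender with `cond ∣ j` (memo F2),
  critical under every convexity / duality / completion step (memo F6).  Stated, not hidden.

**Composition** `CosetDecorrelation_of : K2 → K1 → CosetDecorrelation` is PROVED below (triangle inequality,
`|S(n)S(n')|/j ≤ C₂² M^{3/2−κ}/√M = C₂² M^{1−κ}` using `j ≥ ⌊√M⌋+1 > √M`, and `ϑ := max ϑ₁ (1/4 − κ) < 1/4`).
**Honesty**: the split loses exactly K2 — `meanCorrected_of_cosetDecorrelation : CosetDecorrelation → K2 → K1`
and `split_iff : (K1 ∧ K2) ↔ (CosetDecorrelation ∧ K2)` (sorry-free).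

**Periphery stubs** (ALL NINE LANDED as `--supports stmt-Parity-13317` Theorems files, waves 1–3 of this lead, and re-exported
below by import; they are what the crux CONTAINS / its normal form / its tightness / its obstruction, for the disprover, the
consult and the planner):
`stub_normalForm` (mean coupling, general weights), `stub_cosetParseval` (`j·T_j = Σ_{b mod j} Ĝ_f(b/j)·conj Ĝ_g(b/j)`,
general weights), `stub_welchBound` (Frobenius/Welch: `(Σ_n V_n)² ≤ j·Σ_{n,n'} T_j(n,n')²`, general weights — so
`V_n ≍ M` for all `n ≤ 2M` forces `max_{n≠n'} |T_j| ≫ M^{3/4}`: `ϑ ≥ 0` is necessary), `stub_calibrationL1`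
(`CosetDecorrelation ⇒ Σ_{n≤N} |Σ_{m∼M} λ(mn+c)| ≤ C'(M√N + N·M^{3/4−κ/2})`, a POWER-saving fixed-residue
Bombieri–Vinogradov statement for `λ` at level exactly `1/2`; raw form kernel-checked in `SketchIdeator3.lean`),
`stub_quasiRH_of_progressionMean` (CALIBRATION OF K2: K2 ⇒ `QuasiRiemannHypothesis θ` for some `θ < 3/4` — K2 at
`c = 1, n = 1` is a power saving on the dyadic blocks of `L(x) = Σ_{k≤x} λ(k)`, hence `L(x) ≪ x^θ`,
hence `M(x) = Σ_{d≤√x} μ(d) L(x/d²) ≪ x^θ` (`μ = λ ∗ (μ∘√)`, tree `moebius_eq_sum_sq_dvd`), hence quasi-RH(θ) by the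
Mertens dictionary (tree `quasiRiemannHypothesis_of_mertens_isBigO_holds`, PROVED)),
`stub_welchFloor` (the Welch-floor corollary: `V_n ∈ [M/2, 2M]` for all `n ≤ 2M` forces some `|T_j(n,n')| ≥ M^{3/4}/4`,
`n ≠ n'` — `ϑ ≥ 0` is necessary), `stub_meanFreeEngine` (WHAT THE RESIDUAL IS FOR, memo F3 made exact: mean-free coset
bounds ∧ mean-free fan bounds ∧ one-point `|S(n)| ≤ C·M^{1−κ}` ⇒ the node `DilatedChowla` by the divisor switch — the
route can consume K1-type residuals with a one-point input of the node's own depth `1−κ`, not `3/4`),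
`stub_meanFree_of_meanCorrected` (THE BRIDGE: K1 ∧ one-point(depth 1−κ) ⇒ the mean-free coset input of the engine,
so K1 itself — the registered residual — is what the re-cut engine consumes; also proved below as a named corollary
`dilatedChowla_of_K1`), `stub_characterPretender` (the real-character OBSTRUCTION: with `λ ↦ χ_p`, `p ∣ j` an odd prime,
the mean-corrected coset sum is `≥ M²/(jp) − 2M − 2j ≍ M^{3/2}/p` — K1 and the crux fail for every quadratic pretender;
Jacobsthal).

**Disproof used** (`Cruxes/CosetDecorrelation/Disproof.lean`, cdisprove cycle 1, 2026-08-16T12:05Z; landed Negative lane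
`Theorems/CosetDecorrelation/Negative/CosetDecorrelationDegenerations.lean` p99699 (imported
above so this check sees it) and `…/CosetDecorrelationWindow.lean`.  VERDICT there: no kill — a clean, correctly quantified beyond-GRH conjecture.  Honoured here:
the load-bearing clauses `c ≠ 0` (`Negative.shift_zero`: at `c = 0` the sum is `λ(n)λ(n')·V_j(M)`, a signed variance) and
`n ≠ n'` (`Negative.equalDilations_nonneg`) are kept verbatim in both crux stubs and in the composition; the aligned-shift
degeneration (`Negative.aligned_shift`, `n ∣ c`, `n' ∣ c`: the bounded-lag core `Σ_{m≡m' (j)} λ(m+c/n)λ(m'+c/n')`) is an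
INSTANCE of K1/the crux, not a broken stub; §5 of the Disproof attacks this line and breaks nothing ("no stub broken; nothing
misstated"; K1 ≈ crux in status and in data; K2 is extra debt of the split — exactly `split_iff` below); §6b's pretender
computation is now a THEOREM (`stub_characterPretender`, magnitude `M²/(jp)`, i.e. the crux fails for the χ_p-model for all
`p < M^{1/2+κ}`, correcting the route file's `q ≤ M^{1/4−ϑ}`).  No stub has a window parameter (negatives 4218/9541/14832).

All statements below are DEF-FREE (route vocabulary: `Finset.Ioc`, `Nat.ModEq` filter, `ArithmeticFunction.liouville ∘
Int.toNat`), so that the registered signature is literally what a worker's Theorems file proves.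
-/

namespace Summit.Parity.GeneralizedHardyLittlewood.Cruxes.CosetDecorrelation.FareyLevelMeanCoupling

open Finset
open Summit.Parity.GeneralizedHardyLittlewood.Theses.LiouvilleMAD (CosetDecorrelation)

/-! ## The two crux stubs: named statements -/

/-- K1 — MEAN-CORRECTED COSET DECORRELATION (the residual of the line): the crux's coset sum minus its level-1
term `S(n)S(n')/j` is `≤ C·M^{3/4+ϑ}`, `ϑ < 1/4`, on exactly the crux's ranges.  Equal to
`Σ_{a mod j} (A_n(a) − S(n)/j)(A_{n'}(a) − S(n')/j)` by `stub_normalForm`.  OPEN (crux-grade). -/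
def MeanCorrectedCosetDecorrelation : Prop :=
  ∀ c : ℤ, c ≠ 0 → ∃ ϑ : ℝ, ϑ < 1 / 4 ∧ ∃ C : ℝ, ∀ M n n' j : ℕ, 1 ≤ n → 1 ≤ n' → n ≠ n' →
    n ≤ 2 * M → n' ≤ 2 * M → Nat.sqrt M + 1 ≤ j → j < 2 * (Nat.sqrt M + 1) →
      |(∑ p ∈ (Finset.Ioc M (2 * M) ×ˢ Finset.Ioc M (2 * M)).filter
            (fun p : ℕ × ℕ => p.1 ≡ p.2 [MOD j]),
          (ArithmeticFunction.liouville (Int.toNat ((p.1 : ℤ) * n + c)) : ℝ) *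
            (ArithmeticFunction.liouville (Int.toNat ((p.2 : ℤ) * n' + c)) : ℝ))
        - (∑ m ∈ Finset.Ioc M (2 * M), (ArithmeticFunction.liouville (Int.toNat ((m : ℤ) * n + c)) : ℝ)) *
            (∑ m ∈ Finset.Ioc M (2 * M), (ArithmeticFunction.liouville (Int.toNat ((m : ℤ) * n' + c)) : ℝ)) /
              (j : ℝ)|
        ≤ C * (M : ℝ) ^ (3 / 4 + ϑ)

/-- K2 — ONE-POINT POWER SAVING along the progressions `c mod n` at exponent `3/4 − κ/2`:
`|Σ_{m∈(M,2M]} λ(mn+c)| ≤ C·M^{3/4−κ/2}` for all `1 ≤ n ≤ 2M`.  OPEN (quasi-RH(3/4)-grade at `n = 1`,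
Montgomery-grade for `n ≍ M`). -/
def ProgressionMeanPowerSaving : Prop :=
  ∀ c : ℤ, c ≠ 0 → ∃ κ : ℝ, 0 < κ ∧ ∃ C : ℝ, ∀ M n : ℕ, 1 ≤ n → n ≤ 2 * M →
    |∑ m ∈ Finset.Ioc M (2 * M), (ArithmeticFunction.liouville (Int.toNat ((m : ℤ) * n + c)) : ℝ)|
      ≤ C * (M : ℝ) ^ (3 / 4 - κ / 2)

/-! ## Registered stubs (`sorry` lives only in the two crux stubs K1, K2; the nine periphery stubs are LANDED and
re-exported here from their Theorems files) -/

/-- **STUB K1 · `stub_meanCorrectedCosetDecorrelation`** (= `MeanCorrectedCosetDecorrelation` verbatim) — the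
residual; held by the lead.  OPEN, crux-grade (size XL). -/
theorem stub_meanCorrectedCosetDecorrelation :
    ∀ c : ℤ, c ≠ 0 → ∃ ϑ : ℝ, ϑ < 1 / 4 ∧ ∃ C : ℝ, ∀ M n n' j : ℕ, 1 ≤ n → 1 ≤ n' → n ≠ n' →
    n ≤ 2 * M → n' ≤ 2 * M → Nat.sqrt M + 1 ≤ j → j < 2 * (Nat.sqrt M + 1) →
      |(∑ p ∈ (Finset.Ioc M (2 * M) ×ˢ Finset.Ioc M (2 * M)).filter
            (fun p : ℕ × ℕ => p.1 ≡ p.2 [MOD j]),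
          (ArithmeticFunction.liouville (Int.toNat ((p.1 : ℤ) * n + c)) : ℝ) *
            (ArithmeticFunction.liouville (Int.toNat ((p.2 : ℤ) * n' + c)) : ℝ))
        - (∑ m ∈ Finset.Ioc M (2 * M), (ArithmeticFunction.liouville (Int.toNat ((m : ℤ) * n + c)) : ℝ)) *
            (∑ m ∈ Finset.Ioc M (2 * M), (ArithmeticFunction.liouville (Int.toNat ((m : ℤ) * n' + c)) : ℝ)) /
              (j : ℝ)|
        ≤ C * (M : ℝ) ^ (3 / 4 + ϑ) := by
  sorry

/-- **STUB K2 · `stub_progressionMeanPowerSaving`** (= `ProgressionMeanPowerSaving` verbatim) — the one-point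
companion.  OPEN (size XL; quasi-RH(3/4−κ/2) ⇐ it at `n = 1`). -/
theorem stub_progressionMeanPowerSaving :
    ∀ c : ℤ, c ≠ 0 → ∃ κ : ℝ, 0 < κ ∧ ∃ C : ℝ, ∀ M n : ℕ, 1 ≤ n → n ≤ 2 * M →
    |∑ m ∈ Finset.Ioc M (2 * M), (ArithmeticFunction.liouville (Int.toNat ((m : ℤ) * n + c)) : ℝ)|
      ≤ C * (M : ℝ) ^ (3 / 4 - κ / 2) := by
  sorry

/-- **STUB P1 · `stub_normalForm`** (LANDED p96729, `Theorems/LiouvilleMADCosetDecorrelationStubNormalForm`; general real weights `f, g` on `(M,2M]`):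
MEAN COUPLING — coset sum minus `(Σf)(Σg)/j` equals the inner product of the mean-free class profiles.
(Contains the class-fibration identity `Σ_{m≡m' (j)} f(m)g(m') = Σ_{a<j} (Σ_{m≡a} f)(Σ_{m≡a} g)`.) -/
theorem stub_normalForm :
    ∀ (f g : ℕ → ℝ) (M j : ℕ), 1 ≤ j →
      (∑ p ∈ (Finset.Ioc M (2 * M) ×ˢ Finset.Ioc M (2 * M)).filter
            (fun p : ℕ × ℕ => p.1 ≡ p.2 [MOD j]), f p.1 * g p.2)
        - (∑ m ∈ Finset.Ioc M (2 * M), f m) * (∑ m ∈ Finset.Ioc M (2 * M), g m) / (j : ℝ)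
      = ∑ a ∈ Finset.range j,
          ((∑ m ∈ (Finset.Ioc M (2 * M)).filter (fun m => m ≡ a [MOD j]), f m)
              - (∑ m ∈ Finset.Ioc M (2 * M), f m) / (j : ℝ)) *
            ((∑ m ∈ (Finset.Ioc M (2 * M)).filter (fun m => m ≡ a [MOD j]), g m)
              - (∑ m ∈ Finset.Ioc M (2 * M), g m) / (j : ℝ)) :=
  Summit.Parity.GeneralizedHardyLittlewood.Theorems.CosetDecorrelation.FareyLevelMeanCoupling.stub_normalForm

/-- **STUB P2 · `stub_cosetParseval`** (LANDED p96892, `Theorems/LiouvilleMADCosetDecorrelationStubCosetParseval`; general real weights): PARSEVAL on `ℤ/j`,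
`j · Σ_{m≡m' (j)} f(m)g(m') = Σ_{b<j} Ĝ_f(b/j) · conj Ĝ_g(b/j)` with `Ĝ_f(b/j) = Σ_{m∈(M,2M]} f(m) e(bm/j)`
(orthogonality `Σ_{b<j} e(bk/j) = j·[j ∣ k]`).  The `b = 0` term is the level-1 term `(Σf)(Σg)`. -/
theorem stub_cosetParseval :
    ∀ (f g : ℕ → ℝ) (M j : ℕ), 1 ≤ j →
      ((j : ℂ) * ((∑ p ∈ (Finset.Ioc M (2 * M) ×ˢ Finset.Ioc M (2 * M)).filter
            (fun p : ℕ × ℕ => p.1 ≡ p.2 [MOD j]), f p.1 * g p.2 : ℝ) : ℂ))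
      = ∑ b ∈ Finset.range j,
          (∑ m ∈ Finset.Ioc M (2 * M),
              (f m : ℂ) * Complex.exp (2 * Real.pi * Complex.I * ((b : ℂ) * (m : ℂ) / (j : ℂ)))) *
          (starRingEnd ℂ) (∑ m ∈ Finset.Ioc M (2 * M),
              (g m : ℂ) * Complex.exp (2 * Real.pi * Complex.I * ((b : ℂ) * (m : ℂ) / (j : ℂ)))) :=
  Summit.Parity.GeneralizedHardyLittlewood.Theorems.CosetDecorrelation.FareyLevelMeanCoupling.stub_cosetParseval

/-- **STUB P3 · `stub_welchBound`** (LANDED p96932, `Theorems/LiouvilleMADCosetDecorrelationStubWelchBound`; general real weights `F n` for a finite family of rows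
`n ∈ 𝒩`): FROBENIUS / WELCH — `(Σ_{n∈𝒩} V_n)² ≤ j · Σ_{n,n'∈𝒩} T_j(n,n')²`, where `V_n = Σ_{a<j} (Σ_{m≡a} F n m)²`
is the class variance and `T_j(n,n') = Σ_{m≡m' (j)} F n m · F n' m'` (the Gram matrix `(T_j(n,n'))` is PSD of rank
`≤ j`: `‖G‖_F² ≥ (tr G)²/j`).  With `F n m = λ(mn+c)`, `V_n ≍ M` for all `n ≤ 2M` forces
`max_{n≠n'} |T_j(n,n')| ≫ M^{3/4}`: the exponent `3/4` of the crux cannot be lowered (`ϑ ≥ 0`). -/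
theorem stub_welchBound :
    ∀ (F : ℕ → ℕ → ℝ) (M j : ℕ) (𝒩 : Finset ℕ), 1 ≤ j →
      (∑ n ∈ 𝒩, ∑ a ∈ Finset.range j,
          (∑ m ∈ (Finset.Ioc M (2 * M)).filter (fun m => m ≡ a [MOD j]), F n m) ^ 2) ^ 2
        ≤ (j : ℝ) * ∑ n ∈ 𝒩, ∑ n' ∈ 𝒩,
            (∑ p ∈ (Finset.Ioc M (2 * M) ×ˢ Finset.Ioc M (2 * M)).filter
                (fun p : ℕ × ℕ => p.1 ≡ p.2 [MOD j]), F n p.1 * F n' p.2) ^ 2 :=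
  Summit.Parity.GeneralizedHardyLittlewood.Theorems.CosetDecorrelation.FareyLevelMeanCoupling.stub_welchBound

/-- **STUB P4 · `stub_calibrationL1`** (LANDED p97231, `Theorems/LiouvilleMADCosetDecorrelationStubCalibrationL1`, with the
plain corollary `calibration_tableMean`): WHAT THE CRUX CONTAINS —
`CosetDecorrelation ⇒ Σ_{n≤N} |Σ_{m∈(M,2M]} λ(mn+c)| ≤ C'·(M√N + N·M^{3/4−κ/2})` for all `N ≤ 2M`, some `κ > 0`
(sign-weighted positivity amplifier `(Σ_n w_n S(n))² ≤ j Σ_{n,n'} w_n w_{n'} T_j(n,n')`, trivial diagonal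
`T_j(n,n) ≤ 3M^{3/2}`, the crux on the `N(N−1)` off-diagonal pairs at `j = ⌊√M⌋+1`, `κ = 1/4 − ϑ`): a POWER-saving,
fixed-residue, level-`1/2` Bombieri–Vinogradov statement for `λ` (print and tree have `(log)^{−A}` only). -/
theorem stub_calibrationL1 :
    CosetDecorrelation →
      ∀ c : ℤ, c ≠ 0 → ∃ κ : ℝ, 0 < κ ∧ ∃ C : ℝ, ∀ M N : ℕ, N ≤ 2 * M →
        ∑ n ∈ Finset.Icc 1 N,
            |∑ m ∈ Finset.Ioc M (2 * M), (ArithmeticFunction.liouville (Int.toNat ((m : ℤ) * n + c)) : ℝ)|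
          ≤ C * ((M : ℝ) * Real.sqrt N + (N : ℝ) * (M : ℝ) ^ (3 / 4 - κ / 2)) :=
  Summit.Parity.GeneralizedHardyLittlewood.Theorems.CosetDecorrelation.FareyLevelMeanCoupling.stub_calibrationL1

/-- **STUB P5 · `stub_quasiRH_of_progressionMean`** (LANDED p97406,
`Theorems/LiouvilleMADCosetDecorrelationStubQuasiRHOfProgressionMean`): CALIBRATION OF K2 — the one-point stub
implies the quasi-Riemann hypothesis at some abscissa `θ < 3/4` (`Literature.NumberTheory.LFunctions.QuasiRiemannHypothesis θ`:
no zero of `ζ` with `θ < Re s < 1`).  Route: K2 at `c = 1`, `n = 1` bounds the dyadic blocks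
`Σ_{m∈(M,2M]} λ(m+1) = L(2M+1) − L(M+1)` by `C·M^{3/4−κ/2}`; binary descent gives `|L(x)| ≤ C'x^θ`,
`θ = 3/4 − min κ (1/4) / 2`; `M(x) = Σ_{d ≤ √x} μ(d) L(x/d²)` (tree `Literature.NumberTheory.Sieve.moebius_eq_sum_sq_dvd`)
gives `|M(x)| ≤ C' ζ(2θ) x^θ`; the Mertens dictionary (tree, PROVED:
`Literature.NumberTheory.LFunctions.quasiRiemannHypothesis_of_mertens_isBigO_holds`) gives quasi-RH(θ). -/
theorem stub_quasiRH_of_progressionMean :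
    (∀ c : ℤ, c ≠ 0 → ∃ κ : ℝ, 0 < κ ∧ ∃ C : ℝ, ∀ M n : ℕ, 1 ≤ n → n ≤ 2 * M →
      |∑ m ∈ Finset.Ioc M (2 * M), (ArithmeticFunction.liouville (Int.toNat ((m : ℤ) * n + c)) : ℝ)|
        ≤ C * (M : ℝ) ^ (3 / 4 - κ / 2)) →
      ∃ θ : ℝ, θ < 3 / 4 ∧ Literature.NumberTheory.LFunctions.QuasiRiemannHypothesis θ :=
  Summit.Parity.GeneralizedHardyLittlewood.Theorems.CosetDecorrelation.FareyLevelMeanCoupling.stub_quasiRH_of_progressionMean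

/-- **STUB P6 · `stub_welchFloor`** (LANDED p100157, `Theorems/LiouvilleMADCosetDecorrelationStubWelchFloor`, M₀ = 4096; general real row weights): WELCH FLOOR — for `M ≥ M₀`,
`j ∈ [⌊√M⌋+1, 2⌊√M⌋+2)`, if every row variance `V_n = Σ_{a<j} (Σ_{m≡a (j)} F n m)²`, `1 ≤ n ≤ 2M`, lies in `[M/2, 2M]`
(the random-model diagonal for `F n m = λ(mn+c)`), then SOME off-diagonal coset sum is `≥ M^{3/4}/4`
(`stub_welchBound`: `Σ_{n,n'} T² ≥ (Σ_n V_n)²/j ≥ M⁴/(2√M+2)`, diagonal `≤ 8M³`, `4M²` off-diagonal pairs).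
Tightness of the crux's exponent: `ϑ < 0` is impossible whenever `V_n ≍ M`. -/
theorem stub_welchFloor :
    ∃ M₀ : ℕ, ∀ (F : ℕ → ℕ → ℝ) (M j : ℕ), M₀ ≤ M → Nat.sqrt M + 1 ≤ j → j < 2 * (Nat.sqrt M + 1) →
      (∀ n ∈ Finset.Icc 1 (2 * M), (M : ℝ) / 2 ≤
          ∑ a ∈ Finset.range j, (∑ m ∈ (Finset.Ioc M (2 * M)).filter (fun m => m ≡ a [MOD j]), F n m) ^ 2) →
      (∀ n ∈ Finset.Icc 1 (2 * M),
          ∑ a ∈ Finset.range j, (∑ m ∈ (Finset.Ioc M (2 * M)).filter (fun m => m ≡ a [MOD j]), F n m) ^ 2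
            ≤ 2 * (M : ℝ)) →
      ∃ n ∈ Finset.Icc 1 (2 * M), ∃ n' ∈ Finset.Icc 1 (2 * M), n ≠ n' ∧
        (M : ℝ) ^ (3 / 4 : ℝ) / 4 ≤
          |∑ p ∈ (Finset.Ioc M (2 * M) ×ˢ Finset.Ioc M (2 * M)).filter
              (fun p : ℕ × ℕ => p.1 ≡ p.2 [MOD j]), F n p.1 * F n' p.2| :=
  Summit.Parity.GeneralizedHardyLittlewood.Theorems.CosetDecorrelation.FareyLevelMeanCoupling.stub_welchFloor

/-- **STUB P7 · `stub_meanFreeEngine`** (LANDED p100894, `Theorems/LiouvilleMADCosetDecorrelationStubMeanFreeEngine`): WHAT THE RESIDUAL IS FOR (IdeatorMemo3 §F3 made exact) —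
in the divisor switch `|J|·Σ_m f(m,m) + Σ_{0<|k|≤M} Σ_{j∈J} Σ_{m−m'=kj} f = Σ_{j∈J} Σ_{m≡m' (j)} f` (tree, any weight `f`:
`Theorems.decorrelationToDilatedChowla_divisor_switch`) take the MEAN-FREE weight
`f(m,m') = (λ(mn+c) − S(n)/M)(λ(m'n'+c) − S(n')/M)`, `S(n) = Σ_{m∈(M,2M]} λ(mn+c)`: the diagonal is
`Σ_m λ(mn+c)λ(mn'+c) − S(n)S(n')/M`, so mean-free coset bounds (H1, = the residual K1 up to `O(|S(n)|+|S(n')|+√M)`) and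
mean-free fan bounds (H2) at exponent `3/4+ϑ`, plus a ONE-POINT bound `|S(n)| ≤ C·M^{1−κ}` (H3 — depth `1−κ`, the node's
own depth, NOT the `3/4−κ/2` of K2), give the node `DilatedChowla` BY NAME (fans vanish for `|k| ≥ ⌊√M⌋+1`,
`Theorems.decorrelationToDilatedChowla_fan_eq_zero`; `|S(n)S(n')|/M ≤ C·M^{1−κ}` using `|S(n')| ≤ M`). -/
theorem stub_meanFreeEngine :
    (∀ c : ℤ, c ≠ 0 → ∃ ϑ : ℝ, ϑ < 1 / 4 ∧ ∃ C : ℝ, ∀ M n n' j : ℕ, 1 ≤ n → 1 ≤ n' → n ≠ n' →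
      n ≤ 2 * M → n' ≤ 2 * M → Nat.sqrt M + 1 ≤ j → j < 2 * (Nat.sqrt M + 1) →
        |∑ p ∈ (Finset.Ioc M (2 * M) ×ˢ Finset.Ioc M (2 * M)).filter
            (fun p : ℕ × ℕ => p.1 ≡ p.2 [MOD j]),
          ((ArithmeticFunction.liouville (Int.toNat ((p.1 : ℤ) * n + c)) : ℝ)
            - (∑ m ∈ Finset.Ioc M (2 * M),
                (ArithmeticFunction.liouville (Int.toNat ((m : ℤ) * n + c)) : ℝ)) / (M : ℝ)) *
          ((ArithmeticFunction.liouville (Int.toNat ((p.2 : ℤ) * n' + c)) : ℝ)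
            - (∑ m ∈ Finset.Ioc M (2 * M),
                (ArithmeticFunction.liouville (Int.toNat ((m : ℤ) * n' + c)) : ℝ)) / (M : ℝ))|
          ≤ C * (M : ℝ) ^ (3 / 4 + ϑ)) →
    (∀ c : ℤ, c ≠ 0 → ∃ ϑ : ℝ, ϑ < 1 / 4 ∧ ∃ C : ℝ, ∀ M n n' : ℕ, ∀ k : ℤ, 1 ≤ n → 1 ≤ n' → n ≠ n' →
      n ≤ 2 * M → n' ≤ 2 * M → k ≠ 0 →
        |∑ j ∈ Finset.Ico (Nat.sqrt M + 1) (2 * (Nat.sqrt M + 1)),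
          ∑ p ∈ (Finset.Ioc M (2 * M) ×ˢ Finset.Ioc M (2 * M)).filter
            (fun p : ℕ × ℕ => (p.1 : ℤ) - p.2 = k * (j : ℤ)),
          ((ArithmeticFunction.liouville (Int.toNat ((p.1 : ℤ) * n + c)) : ℝ)
            - (∑ m ∈ Finset.Ioc M (2 * M),
                (ArithmeticFunction.liouville (Int.toNat ((m : ℤ) * n + c)) : ℝ)) / (M : ℝ)) *
          ((ArithmeticFunction.liouville (Int.toNat ((p.2 : ℤ) * n' + c)) : ℝ)
            - (∑ m ∈ Finset.Ioc M (2 * M),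
                (ArithmeticFunction.liouville (Int.toNat ((m : ℤ) * n' + c)) : ℝ)) / (M : ℝ))|
          ≤ C * (M : ℝ) ^ (3 / 4 + ϑ)) →
    (∀ c : ℤ, c ≠ 0 → ∃ κ : ℝ, 0 < κ ∧ ∃ C : ℝ, ∀ M n : ℕ, 1 ≤ n → n ≤ 2 * M →
      |∑ m ∈ Finset.Ioc M (2 * M), (ArithmeticFunction.liouville (Int.toNat ((m : ℤ) * n + c)) : ℝ)|
        ≤ C * (M : ℝ) ^ (1 - κ)) →
    Summit.Parity.GeneralizedHardyLittlewood.Theses.LiouvilleMAD.DilatedChowla :=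
  Summit.Parity.GeneralizedHardyLittlewood.Theorems.CosetDecorrelation.FareyLevelMeanCoupling.stub_meanFreeEngine

/-- **STUB P8 · `stub_meanFree_of_meanCorrected`** (LANDED p103749,
`Theorems/LiouvilleMADCosetDecorrelationStubMeanFreeOfMeanCorrected`): THE BRIDGE from the registered residual K1
(correction `S(n)S(n')/j`) to the mean-free coset input H1 of `stub_meanFreeEngine` (correction by the mean-free profiles
`λ(mn+c) − S(n)/M`), given the one-point bound `|S(n)| ≤ C·M^{1−κ}` (H3): by `stub_normalForm` the two corrected sums are
`Σ_a (A(a) − S/j)(B(a) − S'/j)` and `Σ_a (A(a) − (S/M)c_a)(B(a) − (S'/M)c_a)` with class sizes `|c_a − M/j| < 1`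
(`Nat.Ioc_filter_modEq_card`), so they differ by at most `|S| + |S'| + j ≤ 2C·M^{1−κ} + 2√M + 2`.  Hence
K1 ∧ mean-free fans ∧ one-point(depth 1−κ) ⇒ `DilatedChowla` (with `stub_meanFreeEngine`): the registered residual is
exactly what the re-cut engine consumes. -/
theorem stub_meanFree_of_meanCorrected :
    (∀ c : ℤ, c ≠ 0 → ∃ ϑ : ℝ, ϑ < 1 / 4 ∧ ∃ C : ℝ, ∀ M n n' j : ℕ, 1 ≤ n → 1 ≤ n' → n ≠ n' →
      n ≤ 2 * M → n' ≤ 2 * M → Nat.sqrt M + 1 ≤ j → j < 2 * (Nat.sqrt M + 1) →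
        |(∑ p ∈ (Finset.Ioc M (2 * M) ×ˢ Finset.Ioc M (2 * M)).filter
              (fun p : ℕ × ℕ => p.1 ≡ p.2 [MOD j]),
            (ArithmeticFunction.liouville (Int.toNat ((p.1 : ℤ) * n + c)) : ℝ) *
              (ArithmeticFunction.liouville (Int.toNat ((p.2 : ℤ) * n' + c)) : ℝ))
          - (∑ m ∈ Finset.Ioc M (2 * M), (ArithmeticFunction.liouville (Int.toNat ((m : ℤ) * n + c)) : ℝ)) *
              (∑ m ∈ Finset.Ioc M (2 * M), (ArithmeticFunction.liouville (Int.toNat ((m : ℤ) * n' + c)) : ℝ)) /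
                (j : ℝ)|
          ≤ C * (M : ℝ) ^ (3 / 4 + ϑ)) →
    (∀ c : ℤ, c ≠ 0 → ∃ κ : ℝ, 0 < κ ∧ ∃ C : ℝ, ∀ M n : ℕ, 1 ≤ n → n ≤ 2 * M →
      |∑ m ∈ Finset.Ioc M (2 * M), (ArithmeticFunction.liouville (Int.toNat ((m : ℤ) * n + c)) : ℝ)|
        ≤ C * (M : ℝ) ^ (1 - κ)) →
    (∀ c : ℤ, c ≠ 0 → ∃ ϑ : ℝ, ϑ < 1 / 4 ∧ ∃ C : ℝ, ∀ M n n' j : ℕ, 1 ≤ n → 1 ≤ n' → n ≠ n' →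
      n ≤ 2 * M → n' ≤ 2 * M → Nat.sqrt M + 1 ≤ j → j < 2 * (Nat.sqrt M + 1) →
        |∑ p ∈ (Finset.Ioc M (2 * M) ×ˢ Finset.Ioc M (2 * M)).filter
            (fun p : ℕ × ℕ => p.1 ≡ p.2 [MOD j]),
          ((ArithmeticFunction.liouville (Int.toNat ((p.1 : ℤ) * n + c)) : ℝ)
            - (∑ m ∈ Finset.Ioc M (2 * M),
                (ArithmeticFunction.liouville (Int.toNat ((m : ℤ) * n + c)) : ℝ)) / (M : ℝ)) *
          ((ArithmeticFunction.liouville (Int.toNat ((p.2 : ℤ) * n' + c)) : ℝ)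
            - (∑ m ∈ Finset.Ioc M (2 * M),
                (ArithmeticFunction.liouville (Int.toNat ((m : ℤ) * n' + c)) : ℝ)) / (M : ℝ))|
          ≤ C * (M : ℝ) ^ (3 / 4 + ϑ)) :=
  Summit.Parity.GeneralizedHardyLittlewood.Theorems.CosetDecorrelation.FareyLevelMeanCoupling.stub_meanFree_of_meanCorrected

/-- **STUB P9 · `stub_characterPretender`** (LANDED p103889,
`Theorems/LiouvilleMADCosetDecorrelationStubCharacterPretender`): THE REAL-CHARACTER OBSTRUCTION (cards'
`_false_for_character_model`, IdeatorMemo3 F2 / Ideator2Memo §4): replace `λ` by the quadratic character `χ_p` of an odd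
prime `p` dividing the modulus `j`.  The class profiles are then constant on classes, `A(a) = χ_p(an+c)·c_a` with class sizes
`|c_a − M/j| < 1`, the level-1 term vanishes up to `O(j)` (complete character sums), and the Jacobsthal sum
`Σ_{x mod p} χ_p((xn+c)(xn'+c)) = −χ_p(nn')` (tree: `sum_quadraticChar_add_mul_add`) makes the mean-corrected coset sum
at least `M²/(jp) − 2M − 2j ≍ M^{3/2}/p` in absolute value — so K1 (and the crux) FAIL for every real-character pretender
with `p ∣ j`: any proof must use non-pretentiousness of `λ` at conductors dividing `j ≤ 2√M+2`, quantitatively. -/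
theorem stub_characterPretender :
    ∀ (p : ℕ) [Fact p.Prime], p ≠ 2 → ∀ (c : ℤ), ¬ ((p : ℤ) ∣ c) →
      ∀ (M n n' j : ℕ), 1 ≤ j → p ∣ j → ¬ (p ∣ n) → ¬ (p ∣ n') → ¬ ((p : ℤ) ∣ ((n : ℤ) - (n' : ℤ))) →
        (M : ℝ) ^ 2 / ((j : ℝ) * (p : ℝ)) - 2 * (M : ℝ) - 2 * (j : ℝ) ≤
          |(∑ q ∈ (Finset.Ioc M (2 * M) ×ˢ Finset.Ioc M (2 * M)).filter
                (fun q : ℕ × ℕ => q.1 ≡ q.2 [MOD j]),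
              ((quadraticChar (ZMod p) ((((q.1 : ℤ) * n + c : ℤ)) : ZMod p) : ℤ) : ℝ) *
                ((quadraticChar (ZMod p) ((((q.2 : ℤ) * n' + c : ℤ)) : ZMod p) : ℤ) : ℝ))
            - (∑ m ∈ Finset.Ioc M (2 * M),
                  ((quadraticChar (ZMod p) ((((m : ℤ) * n + c : ℤ)) : ZMod p) : ℤ) : ℝ)) *
                (∑ m ∈ Finset.Ioc M (2 * M),
                  ((quadraticChar (ZMod p) ((((m : ℤ) * n' + c : ℤ)) : ZMod p) : ℤ) : ℝ)) / (j : ℝ)| :=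
  Summit.Parity.GeneralizedHardyLittlewood.Theorems.CosetDecorrelation.FareyLevelMeanCoupling.stub_characterPretender

/-! ### Consistency: each named crux statement IS its registered stub (definitionally) -/

theorem meanCorrectedCosetDecorrelation_holds : MeanCorrectedCosetDecorrelation :=
  stub_meanCorrectedCosetDecorrelation
theorem progressionMeanPowerSaving_holds : ProgressionMeanPowerSaving :=
  stub_progressionMeanPowerSaving

/-- Grade of K2, by name: the one-point stub implies quasi-RH at some abscissa `< 3/4`. -/
theorem quasiRH_of_progressionMeanPowerSaving (h : ProgressionMeanPowerSaving) :
    ∃ θ : ℝ, θ < 3 / 4 ∧ Literature.NumberTheory.LFunctions.QuasiRiemannHypothesis θ :=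
  stub_quasiRH_of_progressionMean h

/-- WHAT K1 IS FOR (memo F3, kernel-checked chain): the registered residual K1, mean-free FAN bounds and a ONE-POINT
bound of depth `1−κ` give the route's node `DilatedChowla` (bridge + engine). -/
theorem dilatedChowla_of_K1 (hK1 : MeanCorrectedCosetDecorrelation)
    (hFan : ∀ c : ℤ, c ≠ 0 → ∃ ϑ : ℝ, ϑ < 1 / 4 ∧ ∃ C : ℝ, ∀ M n n' : ℕ, ∀ k : ℤ, 1 ≤ n → 1 ≤ n' → n ≠ n' →
      n ≤ 2 * M → n' ≤ 2 * M → k ≠ 0 →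
        |∑ j ∈ Finset.Ico (Nat.sqrt M + 1) (2 * (Nat.sqrt M + 1)),
          ∑ p ∈ (Finset.Ioc M (2 * M) ×ˢ Finset.Ioc M (2 * M)).filter
            (fun p : ℕ × ℕ => (p.1 : ℤ) - p.2 = k * (j : ℤ)),
          ((ArithmeticFunction.liouville (Int.toNat ((p.1 : ℤ) * n + c)) : ℝ)
            - (∑ m ∈ Finset.Ioc M (2 * M),
                (ArithmeticFunction.liouville (Int.toNat ((m : ℤ) * n + c)) : ℝ)) / (M : ℝ)) *
          ((ArithmeticFunction.liouville (Int.toNat ((p.2 : ℤ) * n' + c)) : ℝ)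
            - (∑ m ∈ Finset.Ioc M (2 * M),
                (ArithmeticFunction.liouville (Int.toNat ((m : ℤ) * n' + c)) : ℝ)) / (M : ℝ))|
          ≤ C * (M : ℝ) ^ (3 / 4 + ϑ))
    (hP : ∀ c : ℤ, c ≠ 0 → ∃ κ : ℝ, 0 < κ ∧ ∃ C : ℝ, ∀ M n : ℕ, 1 ≤ n → n ≤ 2 * M →
      |∑ m ∈ Finset.Ioc M (2 * M), (ArithmeticFunction.liouville (Int.toNat ((m : ℤ) * n + c)) : ℝ)|
        ≤ C * (M : ℝ) ^ (1 - κ)) :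
    Summit.Parity.GeneralizedHardyLittlewood.Theses.LiouvilleMAD.DilatedChowla :=
  stub_meanFreeEngine (stub_meanFree_of_meanCorrected hK1 hP) hFan hP

/-! ### Name-keyed aliases of the two crux statements (the hypotheses of the composition) -/
namespace Registered

/-- Alias of `MeanCorrectedCosetDecorrelation` keyed by the registered stub name. -/
abbrev stub_meanCorrectedCosetDecorrelation : Prop := MeanCorrectedCosetDecorrelation
/-- Alias of `ProgressionMeanPowerSaving` keyed by the registered stub name. -/
abbrev stub_progressionMeanPowerSaving : Prop := ProgressionMeanPowerSaving

end Registered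

/-! ## Glue (sorry-free): `⌊√M⌋ + 1 > √M` and exponent bookkeeping -/

/-- `√M < ⌊√M⌋ + 1` as reals. -/
theorem sqrt_lt_natSqrt_add_one (M : ℕ) : Real.sqrt M < (Nat.sqrt M + 1 : ℕ) := by
  have h : (M : ℝ) < ((Nat.sqrt M + 1 : ℕ) : ℝ) ^ 2 := by
    exact_mod_cast Nat.lt_succ_sqrt' M
  calc Real.sqrt M < Real.sqrt (((Nat.sqrt M + 1 : ℕ) : ℝ) ^ 2) :=
        Real.sqrt_lt_sqrt (Nat.cast_nonneg _) h
    _ = (Nat.sqrt M + 1 : ℕ) := Real.sqrt_sq (Nat.cast_nonneg _)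

/-- Level-1 bookkeeping: if `|S| ≤ C M^{e}` and `|S'| ≤ C M^{e}` with `e = 3/4 − κ/2`, `M ≥ 1`, `j ≥ ⌊√M⌋+1`, then
`|S·S'/j| ≤ C² · M^{1−κ}`. -/
theorem levelOne_le {S S' C κ : ℝ} {M j : ℕ} (hM : 1 ≤ M) (hj : Nat.sqrt M + 1 ≤ j)
    (hS : |S| ≤ C * (M : ℝ) ^ (3 / 4 - κ / 2)) (hS' : |S'| ≤ C * (M : ℝ) ^ (3 / 4 - κ / 2)) :
    |S * S' / (j : ℝ)| ≤ C ^ 2 * (M : ℝ) ^ (1 - κ) := by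
  have hMpos : (0 : ℝ) < M := by exact_mod_cast hM
  have hjpos : (0 : ℝ) < j := by
    have : 1 ≤ j := le_trans (Nat.succ_le_succ (Nat.zero_le _)) hj
    exact_mod_cast this
  have hsqrt_le_j : Real.sqrt M ≤ (j : ℝ) := by
    have h1 := sqrt_lt_natSqrt_add_one M
    have h2 : ((Nat.sqrt M + 1 : ℕ) : ℝ) ≤ j := by exact_mod_cast hj
    linarith
  have hsqrt_pos : 0 < Real.sqrt M := Real.sqrt_pos.mpr hMpos
  have hE : 0 ≤ (M : ℝ) ^ (3 / 4 - κ / 2) := Real.rpow_nonneg hMpos.le _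
  have hC : 0 ≤ C * (M : ℝ) ^ (3 / 4 - κ / 2) := (abs_nonneg _).trans hS
  -- |S S'| ≤ (C M^e)^2
  have hprod : |S * S'| ≤ (C * (M : ℝ) ^ (3 / 4 - κ / 2)) ^ 2 := by
    rw [abs_mul, sq]
    exact mul_le_mul hS hS' (abs_nonneg _) hC
  -- (C M^e)^2 = C^2 M^{3/2 - κ}
  have hsq : (C * (M : ℝ) ^ (3 / 4 - κ / 2)) ^ 2 = C ^ 2 * (M : ℝ) ^ (3 / 2 - κ) := by
    rw [mul_pow, ← Real.rpow_natCast ((M : ℝ) ^ (3 / 4 - κ / 2)) 2, ← Real.rpow_mul hMpos.le]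
    norm_num
    left
    ring_nf
  -- M^{3/2-κ} / √M = M^{1-κ}
  have hdiv : (M : ℝ) ^ (3 / 2 - κ) / Real.sqrt M = (M : ℝ) ^ (1 - κ) := by
    rw [Real.sqrt_eq_rpow, ← Real.rpow_sub hMpos, show (3 / 2 - κ - 1 / 2 : ℝ) = 1 - κ by ring]
  rw [abs_div, Nat.abs_cast]
  calc |S * S'| / (j : ℝ)
      ≤ (C * (M : ℝ) ^ (3 / 4 - κ / 2)) ^ 2 / (j : ℝ) :=
        div_le_div_of_nonneg_right hprod hjpos.le
    _ ≤ (C * (M : ℝ) ^ (3 / 4 - κ / 2)) ^ 2 / Real.sqrt M :=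
        div_le_div_of_nonneg_left (sq_nonneg _) hsqrt_pos hsqrt_le_j
    _ = C ^ 2 * (M : ℝ) ^ (1 - κ) := by rw [hsq, mul_div_assoc, hdiv]

/-! ## The composition: K2 → K1 → crux, BY NAME (kernel-checked; no `sorry` below this line) -/

/-- **`CosetDecorrelation_of`** — the glue of the line: triangle inequality
`|T_j| ≤ |T_j − S S'/j| + |S S'/j|`, K1 on the first term, K2 twice + `levelOne_le` on the second, and
`ϑ := max ϑ₁ (1/4 − κ) < 1/4`, `C := max C₁ 0 + C₂²`. -/
theorem CosetDecorrelation_of (h2 : Registered.stub_progressionMeanPowerSaving)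
    (h1 : Registered.stub_meanCorrectedCosetDecorrelation) : CosetDecorrelation := by
  intro c hc
  obtain ⟨κ, hκ, C₂, hS⟩ := h2 c hc
  obtain ⟨ϑ₁, hϑ₁, C₁, hT⟩ := h1 c hc
  refine ⟨max ϑ₁ (1 / 4 - κ), max_lt hϑ₁ (by linarith), max C₁ 0 + C₂ ^ 2, ?_⟩
  intro M n n' j hn hn' hne hnM hn'M hj1 hj2
  have hM : 1 ≤ M := by omega
  have hMr : (1 : ℝ) ≤ M := by exact_mod_cast hM
  have hMpos : (0 : ℝ) < M := by linarith
  -- the three pieces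
  set T : ℝ := ∑ p ∈ (Finset.Ioc M (2 * M) ×ˢ Finset.Ioc M (2 * M)).filter
      (fun p : ℕ × ℕ => p.1 ≡ p.2 [MOD j]),
    (ArithmeticFunction.liouville (Int.toNat ((p.1 : ℤ) * n + c)) : ℝ) *
      (ArithmeticFunction.liouville (Int.toNat ((p.2 : ℤ) * n' + c)) : ℝ) with hTdef
  set S : ℝ := ∑ m ∈ Finset.Ioc M (2 * M),
    (ArithmeticFunction.liouville (Int.toNat ((m : ℤ) * n + c)) : ℝ) with hSdef
  set S' : ℝ := ∑ m ∈ Finset.Ioc M (2 * M),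
    (ArithmeticFunction.liouville (Int.toNat ((m : ℤ) * n' + c)) : ℝ) with hS'def
  have e1 : |T - S * S' / (j : ℝ)| ≤ C₁ * (M : ℝ) ^ (3 / 4 + ϑ₁) :=
    hT M n n' j hn hn' hne hnM hn'M hj1 hj2
  have e2 : |S * S' / (j : ℝ)| ≤ C₂ ^ 2 * (M : ℝ) ^ (1 - κ) :=
    levelOne_le hM hj1 (hS M n hn hnM) (hS M n' hn' hn'M)
  -- monotonicity in the exponent (M ≥ 1)
  have m1 : (M : ℝ) ^ (3 / 4 + ϑ₁) ≤ (M : ℝ) ^ (3 / 4 + max ϑ₁ (1 / 4 - κ)) :=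
    Real.rpow_le_rpow_of_exponent_le hMr (by linarith [le_max_left ϑ₁ (1 / 4 - κ)])
  have m2 : (M : ℝ) ^ (1 - κ) ≤ (M : ℝ) ^ (3 / 4 + max ϑ₁ (1 / 4 - κ)) :=
    Real.rpow_le_rpow_of_exponent_le hMr (by linarith [le_max_right ϑ₁ (1 / 4 - κ)])
  have hpow₁ : 0 ≤ (M : ℝ) ^ (3 / 4 + ϑ₁) := Real.rpow_nonneg hMpos.le _
  have e1' : |T - S * S' / (j : ℝ)| ≤ max C₁ 0 * (M : ℝ) ^ (3 / 4 + max ϑ₁ (1 / 4 - κ)) :=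
    calc |T - S * S' / (j : ℝ)| ≤ C₁ * (M : ℝ) ^ (3 / 4 + ϑ₁) := e1
      _ ≤ max C₁ 0 * (M : ℝ) ^ (3 / 4 + ϑ₁) :=
          mul_le_mul_of_nonneg_right (le_max_left _ _) hpow₁
      _ ≤ max C₁ 0 * (M : ℝ) ^ (3 / 4 + max ϑ₁ (1 / 4 - κ)) :=
          mul_le_mul_of_nonneg_left m1 (le_max_right _ _)
  have e2' : |S * S' / (j : ℝ)| ≤ C₂ ^ 2 * (M : ℝ) ^ (3 / 4 + max ϑ₁ (1 / 4 - κ)) :=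
    e2.trans (mul_le_mul_of_nonneg_left m2 (sq_nonneg _))
  have hsplit : T = (T - S * S' / (j : ℝ)) + S * S' / (j : ℝ) := by ring
  calc |T| = |(T - S * S' / (j : ℝ)) + S * S' / (j : ℝ)| := by rw [← hsplit]
    _ ≤ |T - S * S' / (j : ℝ)| + |S * S' / (j : ℝ)| := abs_add_le _ _
    _ ≤ max C₁ 0 * (M : ℝ) ^ (3 / 4 + max ϑ₁ (1 / 4 - κ)) +
          C₂ ^ 2 * (M : ℝ) ^ (3 / 4 + max ϑ₁ (1 / 4 - κ)) := add_le_add e1' e2'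
    _ = (max C₁ 0 + C₂ ^ 2) * (M : ℝ) ^ (3 / 4 + max ϑ₁ (1 / 4 - κ)) := by ring

/-- Wiring check: the registered stubs feed `CosetDecorrelation_of` as stated. -/
example : CosetDecorrelation :=
  CosetDecorrelation_of stub_progressionMeanPowerSaving stub_meanCorrectedCosetDecorrelation

/-! ## Honesty: the split loses exactly K2 (both directions, sorry-free) -/

/-- Crux ∧ K2 ⇒ K1: `|T − SS'/j| ≤ |T| + |SS'/j|`, same bookkeeping. -/
theorem meanCorrected_of_cosetDecorrelation (hC : CosetDecorrelation) (h2 : ProgressionMeanPowerSaving) :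
    MeanCorrectedCosetDecorrelation := by
  intro c hc
  obtain ⟨κ, hκ, C₂, hS⟩ := h2 c hc
  obtain ⟨ϑ₁, hϑ₁, C₁, hT⟩ := hC c hc
  refine ⟨max ϑ₁ (1 / 4 - κ), max_lt hϑ₁ (by linarith), max C₁ 0 + C₂ ^ 2, ?_⟩
  intro M n n' j hn hn' hne hnM hn'M hj1 hj2
  have hM : 1 ≤ M := by omega
  have hMr : (1 : ℝ) ≤ M := by exact_mod_cast hM
  have hMpos : (0 : ℝ) < M := by linarith
  set T : ℝ := ∑ p ∈ (Finset.Ioc M (2 * M) ×ˢ Finset.Ioc M (2 * M)).filter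
      (fun p : ℕ × ℕ => p.1 ≡ p.2 [MOD j]),
    (ArithmeticFunction.liouville (Int.toNat ((p.1 : ℤ) * n + c)) : ℝ) *
      (ArithmeticFunction.liouville (Int.toNat ((p.2 : ℤ) * n' + c)) : ℝ) with hTdef
  set S : ℝ := ∑ m ∈ Finset.Ioc M (2 * M),
    (ArithmeticFunction.liouville (Int.toNat ((m : ℤ) * n + c)) : ℝ) with hSdef
  set S' : ℝ := ∑ m ∈ Finset.Ioc M (2 * M),
    (ArithmeticFunction.liouville (Int.toNat ((m : ℤ) * n' + c)) : ℝ) with hS'def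
  have e1 : |T| ≤ C₁ * (M : ℝ) ^ (3 / 4 + ϑ₁) := hT M n n' j hn hn' hne hnM hn'M hj1 hj2
  have e2 : |S * S' / (j : ℝ)| ≤ C₂ ^ 2 * (M : ℝ) ^ (1 - κ) :=
    levelOne_le hM hj1 (hS M n hn hnM) (hS M n' hn' hn'M)
  have m1 : (M : ℝ) ^ (3 / 4 + ϑ₁) ≤ (M : ℝ) ^ (3 / 4 + max ϑ₁ (1 / 4 - κ)) :=
    Real.rpow_le_rpow_of_exponent_le hMr (by linarith [le_max_left ϑ₁ (1 / 4 - κ)])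
  have m2 : (M : ℝ) ^ (1 - κ) ≤ (M : ℝ) ^ (3 / 4 + max ϑ₁ (1 / 4 - κ)) :=
    Real.rpow_le_rpow_of_exponent_le hMr (by linarith [le_max_right ϑ₁ (1 / 4 - κ)])
  have hpow₁ : 0 ≤ (M : ℝ) ^ (3 / 4 + ϑ₁) := Real.rpow_nonneg hMpos.le _
  have e1' : |T| ≤ max C₁ 0 * (M : ℝ) ^ (3 / 4 + max ϑ₁ (1 / 4 - κ)) :=
    calc |T| ≤ C₁ * (M : ℝ) ^ (3 / 4 + ϑ₁) := e1
      _ ≤ max C₁ 0 * (M : ℝ) ^ (3 / 4 + ϑ₁) :=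
          mul_le_mul_of_nonneg_right (le_max_left _ _) hpow₁
      _ ≤ max C₁ 0 * (M : ℝ) ^ (3 / 4 + max ϑ₁ (1 / 4 - κ)) :=
          mul_le_mul_of_nonneg_left m1 (le_max_right _ _)
  have e2' : |S * S' / (j : ℝ)| ≤ C₂ ^ 2 * (M : ℝ) ^ (3 / 4 + max ϑ₁ (1 / 4 - κ)) :=
    e2.trans (mul_le_mul_of_nonneg_left m2 (sq_nonneg _))
  calc |T - S * S' / (j : ℝ)| ≤ |T| + |S * S' / (j : ℝ)| := abs_sub _ _
    _ ≤ max C₁ 0 * (M : ℝ) ^ (3 / 4 + max ϑ₁ (1 / 4 - κ)) +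
          C₂ ^ 2 * (M : ℝ) ^ (3 / 4 + max ϑ₁ (1 / 4 - κ)) := add_le_add e1' e2'
    _ = (max C₁ 0 + C₂ ^ 2) * (M : ℝ) ^ (3 / 4 + max ϑ₁ (1 / 4 - κ)) := by ring

/-- The split is lossless modulo K2: `K1 ∧ K2 ↔ CosetDecorrelation ∧ K2`. -/
theorem split_iff :
    (MeanCorrectedCosetDecorrelation ∧ ProgressionMeanPowerSaving) ↔
      (CosetDecorrelation ∧ ProgressionMeanPowerSaving) :=
  ⟨fun h => ⟨CosetDecorrelation_of h.2 h.1, h.2⟩,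
   fun h => ⟨meanCorrected_of_cosetDecorrelation h.1 h.2, h.2⟩⟩

end Summit.Parity.GeneralizedHardyLittlewood.Cruxes.CosetDecorrelation.FareyLevelMeanCoupling
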